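import Summits.HodgeConjecture.CorCM.Census.QuaternionColumnOddFibre
import Summits.HodgeConjecture.CorCM.Census.QuaternionEightFibre
import Summits.HodgeConjecture.CorCM.Census.DicyclicTwistLaw

/-!
# The quaternion column, ALL LEVELS: `μ(Q_{4n}, c) = φ₂(Q_{4n}, c) = β(Q_{4n}, c) − [n odd]` for every `n ≥ 2`

COR-CM (cell `pub-hodgecm2`), count-neutral kernel combinatorics by the binder seat b09 (gen 41; lane CYCLIC-CHARACTER FIBRE LAW, part IV — the assembly
of the quaternion / dicyclic column in ONE currency `QuaternionGroup n`, `c = a n`), on top of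
* seat b23ʼs DICYCLIC LAW (`Census/DicyclicTwistLaw.isLeast_card_gfaces_generate'`: `μ = β − 1` along every dicyclic datum `Dic(ℤ/2 × A, c)`, `|A| ≥ 3`)
  — instantiated here on `Q_{4n}`, `n` ODD, through the datum `ℤ/2 × ℤ/n ≅ ℤ/2n = ⟨a⟩` (Chinese remainder), `x = xa 0` (§1);
* gen 38ʼs `Census/QuaternionEightFibre.isLeast_card_gfaces_generate_two` (`μ(Q₈) = 2`), gen 40ʼs
  `Census/QuaternionColumnEvenLaw.isLeast_card_gfaces_generate_quaternion_even_law` (`μ = φ₂`, even `n ≥ 4`) and part III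
  (`Census/QuaternionColumnOddFibre.lean`: `φ₂ + [n odd] = β`), all BY NAME.
Theorems only (no definition — the datum is an existence statement —, no `decide`, no certificate, no named fact, no `sorry`).
HONEST FRAMING: `HC_CM` is NOT proved, here or anywhere in the tree; nothing here is a period or a headline.

* §1 **the dicyclic datum on `Q_{4n}`, `n` odd** (`nonempty_datum_of_odd`): `ι (e, u) = a (crt⁻¹ (e, u))`, `x = xa 0`; `ι (1, 0) = a n = c` because `n` is odd.
* §2 **`μ(Q_{4n}, c) = β − 1 = φ₂` for every odd `n ≥ 3`** (`isLeast_card_gfaces_generate_quaternion_odd`, `…_odd_fibreTwo`).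
* §3 **THE COLUMN, ALL LEVELS** (`isLeast_card_gfaces_generate_quaternion_all`): for EVERY `n ≥ 2` the least number of rank-four face relations whose base
  changes generate the integer Hodge lattice of `(Q_{4n}, c)` modulo the pairs is EXACTLY `φ₂(Q_{4n}, c)` — `= β` for even `n`, `= β − 1` for odd `n`
  (`isLeast_card_gfaces_generate_quaternion_all_card_block`).  Census dictionary: for every Galois CM field with group `Q_{4n}` (generalised quaternion /
  dicyclic, any `n ≥ 2`; complex conjugation is the unique central involution) the Hodge ring of the whole slice is generated modulo divisor classes by the
  Galois conjugates of exactly `φ₂` rank-four face classes and no fewer Hodge generators of any kind exist modulo pairs.  Nothing here is a period.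

## References
* [Pohlmann1968] H. Pohlmann, Algebraic cycles on abelian varieties of complex multiplication type, Ann. of Math. 88 (1968), Thm 1.
* [Milne1999] J. S. Milne, Lefschetz motives and the Tate conjecture, Compositio Math. 117 (1999), Prop. 2.1, p. 54.
-/

namespace Summit.HodgeConjecture.CorCM.Census.QuaternionColumn

open Finset QuaternionGroup
open Summit.HodgeConjecture.CorCM.Prior.AllgGroup.RfwfAllgGroup
open Summit.HodgeConjecture.CorCM.Census.BlockParity
open Summit.HodgeConjecture.CorCM.Census.Coinvariant

noncomputable section

variable {n : ℕ} [NeZero n]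

/-! ## §1 The dicyclic datum on `Q_{4n}` for odd `n` -/

omit [NeZero n] in
/-- **`Q_{4n}` carries a dicyclic datum over `ℤ/n` when `n` is odd**: `ι (e, u) = a (crt⁻¹ (e, u))` (`ℤ/2 × ℤ/n ≅ ℤ/2n`, Chinese remainder), `x = xa 0`,
`ι (1, 0) = a n = c`. [folklore] -/
theorem nonempty_datum_of_odd (hodd : Odd n) : Nonempty (DicyclicTwist.Datum (QuaternionGroup n) (c n) (ZMod n)) := by
  have hcop : Nat.Coprime 2 n := Nat.coprime_two_left.mpr hodd
  set e : ZMod 2 × ZMod n ≃+* ZMod (2 * n) := (ZMod.chineseRemainder hcop).symm with he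
  have hfwd : ZMod.chineseRemainder hcop ((n : ℕ) : ZMod (2 * n)) = (1, 0) := by
    rw [map_natCast, Prod.ext_iff, Prod.fst_natCast, Prod.snd_natCast, ZMod.natCast_self, ZMod.natCast_eq_one_iff_odd]
    exact ⟨hodd, rfl⟩
  have he10 : e (1, 0) = (n : ℕ) := by rw [he, ← hfwd, RingEquiv.symm_apply_apply]
  refine ⟨{ ι := (fun p => a (e p)), x := xa 0, map_add := ?_, map_c := ?_, x_mul := ?_, x_mul_x := ?_, inj := ?_, x_ne := ?_,
            exhaust := ?_ }⟩
  · intro p q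
    rw [map_add, a_mul_a]
  · show a (e (1, 0)) = c n
    rw [he10]
    rfl
  · intro p
    show xa 0 * a (e p) = a (e (-p)) * xa 0
    rw [xa_mul_a, a_mul_xa, map_neg, zero_add, sub_neg_eq_add, zero_add]
  · show xa (0 : ZMod (2 * n)) * xa 0 = c n
    rw [xa_mul_xa, add_zero, sub_zero]
    rfl
  · intro p q h
    exact e.injective (a.inj h)
  · intro p h
    cases h
  · intro g
    cases g with
    | a i => exact ⟨e.symm i, Or.inl (by rw [RingEquiv.apply_symm_apply])⟩
    | xa i => exact ⟨e.symm i, Or.inr (by rw [RingEquiv.apply_symm_apply, xa_mul_a, zero_add])⟩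

/-! ## §2 The law at odd level `n ≥ 3` -/

/-- **`μ(Q_{4n}, c) = β(Q_{4n}, c) − 1` for every ODD `n ≥ 3`** — seat b23ʼs dicyclic law along the datum of §1. [folklore] -/
theorem isLeast_card_gfaces_generate_quaternion_odd (hodd : Odd n) (h3 : 3 ≤ n) :
    IsLeast {k : ℕ | ∃ S : Finset (CMF (QuaternionGroup n) (c n) →₀ ℤ), (↑S ⊆ gfaceSet (QuaternionGroup n) (c n) c_mul_c) ∧ S.card = k ∧
      hodgeSpan (c n) c_mul_c ≤ Submodule.span ℤ (pairSet (c n)) ⊔ Submodule.span ℤ (translates (c n) S)}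
      (Fintype.card (Block (c n)) - 1) := by
  obtain ⟨D⟩ := nonempty_datum_of_odd hodd
  exact DicyclicTwist.isLeast_card_gfaces_generate' D c_mul_c (by rwa [ZMod.card])

/-- **`μ(Q_{4n}, c) = φ₂(Q_{4n}, c)` for every odd `n ≥ 3`.** [folklore] -/
theorem isLeast_card_gfaces_generate_quaternion_odd_fibreTwo (hodd : Odd n) (h3 : 3 ≤ n) :
    IsLeast {k : ℕ | ∃ S : Finset (CMF (QuaternionGroup n) (c n) →₀ ℤ), (↑S ⊆ gfaceSet (QuaternionGroup n) (c n) c_mul_c) ∧ S.card = k ∧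
      hodgeSpan (c n) c_mul_c ≤ Submodule.span ℤ (pairSet (c n)) ⊔ Submodule.span ℤ (translates (c n) S)} (fibreTwo (c n) c_mul_c) := by
  rw [fibreTwo_eq_card_block_sub_one_odd hodd]
  exact isLeast_card_gfaces_generate_quaternion_odd hodd h3

/-! ## §3 The quaternion column at every level `n ≥ 2` -/

/-- **`μ(Q₈, c) = φ₂(Q₈, c)`** (gen 38ʼs row `μ(Q₈) = 2 = φ₂` in the column currency `c 2 = a 2`). [folklore] -/
theorem isLeast_card_gfaces_generate_quaternion_two :
    IsLeast {k : ℕ | ∃ S : Finset (CMF (QuaternionGroup 2) (c 2) →₀ ℤ), (↑S ⊆ gfaceSet (QuaternionGroup 2) (c 2) c_mul_c) ∧ S.card = k ∧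
      hodgeSpan (c 2) c_mul_c ≤ Submodule.span ℤ (pairSet (c 2)) ⊔ Submodule.span ℤ (translates (c 2) S)} (fibreTwo (c 2) c_mul_c) :=
  QuaternionEight.isLeast_card_gfaces_generate_quaternionEight

/-- **THE QUATERNION COLUMN, ALL LEVELS: `μ(Q_{4n}, c) = φ₂(Q_{4n}, c)` for EVERY `n ≥ 2`** (`n = 2`: gen 38; `n` odd: §2; `n ≥ 4` even: gen 40). [folklore] -/
theorem isLeast_card_gfaces_generate_quaternion_all (h2 : 2 ≤ n) :
    IsLeast {k : ℕ | ∃ S : Finset (CMF (QuaternionGroup n) (c n) →₀ ℤ), (↑S ⊆ gfaceSet (QuaternionGroup n) (c n) c_mul_c) ∧ S.card = k ∧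
      hodgeSpan (c n) c_mul_c ≤ Submodule.span ℤ (pairSet (c n)) ⊔ Submodule.span ℤ (translates (c n) S)} (fibreTwo (c n) c_mul_c) := by
  rcases Nat.even_or_odd n with heven | hodd
  · by_cases h4 : 4 ≤ n
    · exact isLeast_card_gfaces_generate_quaternion_even_law heven h4
    · obtain ⟨m, hm⟩ := heven
      have hn2 : n = 2 := by omega
      subst hn2
      exact isLeast_card_gfaces_generate_quaternion_two
  · have h3 : 3 ≤ n := by
      obtain ⟨m, hm⟩ := hodd
      omega
    exact isLeast_card_gfaces_generate_quaternion_odd_fibreTwo hodd h3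

/-- **THE QUATERNION COLUMN IN CLOSED FORM: `μ(Q_{4n}, c) = β(Q_{4n}, c) − [n odd]` for every `n ≥ 2`.** [folklore] -/
theorem isLeast_card_gfaces_generate_quaternion_all_card_block (h2 : 2 ≤ n) :
    IsLeast {k : ℕ | ∃ S : Finset (CMF (QuaternionGroup n) (c n) →₀ ℤ), (↑S ⊆ gfaceSet (QuaternionGroup n) (c n) c_mul_c) ∧ S.card = k ∧
      hodgeSpan (c n) c_mul_c ≤ Submodule.span ℤ (pairSet (c n)) ⊔ Submodule.span ℤ (translates (c n) S)}
      (Fintype.card (Block (c n)) - (if Even n then 0 else 1)) := by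
  have h := isLeast_card_gfaces_generate_quaternion_all h2
  have hlaw := fibreTwo_add_eq_card_block_all (n := n)
  have e : Fintype.card (Block (c n)) - (if Even n then 0 else 1) = fibreTwo (c n) c_mul_c := by
    split_ifs at hlaw ⊢ <;> omega
  rwa [e]

end

end Summit.HodgeConjecture.CorCM.Census.QuaternionColumn
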